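import Literature.Probability.RandomPlanarGeometry.HexSAWPolygonTallThird
import Literature.Probability.RandomPlanarGeometry.HexSAWPolygonMadrasBootstrap
import HarnessLib

/-!
# Madras' `θ ≥ 1/2` on the honeycomb lattice: the join-map specification, the domain of the join and its size, and the assembly
# (stubs S5ℍ-count and the skeleton of LINE «HEX-MADRAS»; the line is closed modulo ONE `Prop`, the injective join map)

Topic `Literature/Probability/RandomPlanarGeometry` (lane «pcv-sawmu», a-p4 g12; continues `HexSAWPolygonTallThird.lean` (`canonEnd`-level tall
third `card_canonEnd_le_three_mul_tall`, `le_two_mul_sq_rowCount_of_mem_tallCanon`, `rowCount`, `tallCanon`) and `HexSAWPolygonMadrasBootstrap.lean`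
(`hexPolygonNumber_le_rpow_of_joinIneq`: any even-length `√N`-gain join inequality gives `q_N(ℍ) ≤ A·N^{−1/2}·μ_ℍ^N`); the `𝕋` twins are TREE
`SAWTriangularPolygonJoinSpec.lean` and `SAWTriangularPolygonJoinCount.lean`).

Source.  N. Madras, J. Stat. Phys. 78 (1995) 681–699 [Madras1995LatticeAnimalsExponent], §2 (two dimensions, `ℤ²`: a tall polygon `ω`
(height `≥ n^{1/2}`) and an arbitrary polygon `σ` are joined INJECTIVELY after translating `σ` vertically to any of `≥ height(ω)` relative positions —
"there are at least an order of `n^ν` locations to which `φ'` may be translated and then attached to `φ`" (there `ν = 1/2`), as recalled by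
A. Hammond, arXiv:1504.05286v5 [Hammond2015SAPJoining], §3.4 p. 12 and §4.1 pp. 17–20, Definition 4.3 p. 20 (the Madras join polygon), Lemma 4.9
pp. 24–25).
Here: the honeycomb lattice in the brick-wall frame, with Supermult's canonical traversals `canonEnd n` (one per translation class of
`(n+1)`-gons, `#canonEnd n = q_{n+1}(ℍ)`).  This file fixes the SHAPE of the join map as a `Prop`, the DOMAIN (tall class × any class × row
offset) with its size `≥ (1/(3√2))·√(n+1)·q_{n+1}(ℍ)²`, and proves the assembly down to `q_N(ℍ) ≤ A·N^{−1/2}·√(2+√2)^N`; the map itself — slide to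
first contact, cap, merge across one brick, decode (stubs S2ℍ–S4ℍ of `DESIGN-hex-madras-sqrtN.md`) — is the ONE remaining input.

## Contents (namespace `Literature.Probability.RandomPlanarGeometry.SAW`, sub-namespace `HexBW` for the domain)
* `HexBW.visitedRows`, `HexBW.joinOffsets n ω σ` (`#· = rowCount (n+1) ω`), `HexBW.joinDomain n` (`Σ`-type: tall traversal × traversal × offset),
  `HexBW.card_joinDomain`, `HexBW.sqrt_le_rowCount`, **`HexBW.card_joinDomain_ge : (1/3)·√((n+1)/2)·(#canonEnd n)² ≤ #joinDomain n`**;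
* `JoinMapSpecHex c K N` — a finite domain of size `≥ c·√N·q_N(ℍ)²` mapped injectively into `canonEnd (2N + K − 1)`;
  `joinIneqHex_of_spec : JoinMapSpecHex c K N → c·√N·q_N(ℍ)² ≤ q_{2N+K}(ℍ)` (`2N + K ≥ 3`);
* **`hexPolygonNumber_le_rpow_of_joinMapSpec`** — `JoinMapSpecHex c K N` for all even `N ≥ N₀` (`c > 0`, `K` even) gives
  `∃ A, ∀ N ≥ 1, q_N(ℍ) ≤ A·N^{−1/2}·μ_ℍ^N`, and `…_sqrt_…` with `√(2+√2)`;
* **`joinMapSpecHex_of_injOn`** — an injective map `HexBW.joinDomain (N−1) → canonEnd (2N+K−1)` witnesses `JoinMapSpecHex (1/(3√2)) K N`.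
-/

noncomputable section

open Finset Literature.Probability.LatticeModels Literature.Probability.Percolation

namespace Literature.Probability.RandomPlanarGeometry.SAW

namespace HexBW

open PolygonConcat

variable {n : ℕ} {ω σ : ℕ → Site 2}

open Classical in
/-- The rows visited by `ω` on `[0, n]`. [cite: Madras1995LatticeAnimalsExponent, §2 (height of a polygon; primary, not held by the lane)] -/
def visitedRows (n : ℕ) (ω : ℕ → Site 2) : Finset ℤ := (range (n + 1)).image fun i => ω i 1

/-- `#visitedRows = rowCount (n+1)`. [cite: Madras1995LatticeAnimalsExponent, §2] -/
theorem card_visitedRows (n : ℕ) (ω : ℕ → Site 2) : #(visitedRows n ω) = rowCount (n + 1) ω := rfl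

/-- membership in `visitedRows`. [cite: Madras1995LatticeAnimalsExponent, §2] -/
theorem mem_visitedRows {y : ℤ} : y ∈ visitedRows n ω ↔ ∃ i, i ≤ n ∧ ω i 1 = y := by
  classical
  simp only [visitedRows, Finset.mem_image, Finset.mem_range, Nat.lt_succ_iff]

open Classical in
/-- **Admissible vertical offsets**: `τ` such that the root row of `σ` translated by `τ` is a row of `ω` (on `ℍ` the horizontal component of
the translation is then chosen with the parity of `τ`, so that the translate stays in the brick wall).
[cite: Madras1995LatticeAnimalsExponent, §2; Hammond2015SAPJoining, §3.4 (arXiv v5 p. 12: "an order of `n^ν` locations to which `φ'` may be translated and then attached to `φ`"; `ν = 1/2` = `√n` rows here)] -/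
def joinOffsets (n : ℕ) (ω σ : ℕ → Site 2) : Finset ℤ := (visitedRows n ω).image fun y => y - σ 0 1

/-- `#joinOffsets = rowCount ω`. [cite: Madras1995LatticeAnimalsExponent, §2] -/
theorem card_joinOffsets (n : ℕ) (ω σ : ℕ → Site 2) : #(joinOffsets n ω σ) = rowCount (n + 1) ω := by
  classical
  rw [joinOffsets, Finset.card_image_of_injective _ (sub_left_injective), card_visitedRows]

/-- membership in `joinOffsets`. [cite: Madras1995LatticeAnimalsExponent, §2] -/
theorem mem_joinOffsets {τ : ℤ} : τ ∈ joinOffsets n ω σ ↔ ∃ i, i ≤ n ∧ ω i 1 = σ 0 1 + τ := by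
  classical
  simp only [joinOffsets, Finset.mem_image, mem_visitedRows]
  constructor
  · rintro ⟨y, ⟨i, hi, rfl⟩, rfl⟩; exact ⟨i, hi, by ring⟩
  · rintro ⟨i, hi, h⟩; exact ⟨ω i 1, ⟨i, hi, rfl⟩, by rw [h]; ring⟩

/-- **The domain of the join map on `ℍ`**: triples `(ω, σ, τ)` — a tall canonical traversal, any canonical traversal, an admissible offset.
[cite: Madras1995LatticeAnimalsExponent, §2; Hammond2015SAPJoining, §3.4 (arXiv v5 p. 12)] -/
def joinDomain (n : ℕ) : Finset (Σ _ : (ℕ → Site 2) × (ℕ → Site 2), ℤ) :=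
  (tallCanon n ×ˢ canonEnd n).sigma fun x => joinOffsets n x.1 x.2

/-- membership in `joinDomain`. [cite: Madras1995LatticeAnimalsExponent, §2] -/
theorem mem_joinDomain {x : Σ _ : (ℕ → Site 2) × (ℕ → Site 2), ℤ} :
    x ∈ joinDomain n ↔ x.1.1 ∈ tallCanon n ∧ x.1.2 ∈ canonEnd n ∧ x.2 ∈ joinOffsets n x.1.1 x.1.2 := by
  rw [joinDomain, Finset.mem_sigma, Finset.mem_product, and_assoc]

/-- **Size of the domain**: `#joinDomain n = #canonEnd n · Σ_{ω tall} rowCount ω`. [cite: Madras1995LatticeAnimalsExponent, §2] -/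
theorem card_joinDomain (n : ℕ) : #(joinDomain n) = #(canonEnd n) * ∑ ω ∈ tallCanon n, rowCount (n + 1) ω := by
  classical
  rw [joinDomain, Finset.card_sigma, Finset.sum_product]
  simp only [card_joinOffsets, Finset.sum_const, smul_eq_mul]
  rw [Finset.mul_sum]

/-- **A tall traversal has at least `√((n+1)/2)` rows.** [cite: Madras1995LatticeAnimalsExponent, §2; Hammond2015SAPJoining, Definition 4.8 (arXiv v5 p. 24)] -/
theorem sqrt_le_rowCount (hω : ω ∈ tallCanon n) : Real.sqrt ((n + 1) / 2) ≤ (rowCount (n + 1) ω : ℝ) := by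
  have h := le_two_mul_sq_rowCount_of_mem_tallCanon hω
  have h' : ((n : ℝ) + 1) / 2 ≤ (rowCount (n + 1) ω : ℝ) ^ 2 := by
    rw [div_le_iff₀ (by norm_num : (0 : ℝ) < 2)]
    exact_mod_cast (by linarith : n + 1 ≤ rowCount (n + 1) ω ^ 2 * 2)
  calc Real.sqrt ((n + 1) / 2) ≤ Real.sqrt ((rowCount (n + 1) ω : ℝ) ^ 2) := Real.sqrt_le_sqrt h'
    _ = (rowCount (n + 1) ω : ℝ) := Real.sqrt_sq (Nat.cast_nonneg _)

/-- **The domain is large**: `(1/3)·√((n+1)/2)·(#canonEnd n)² ≤ #joinDomain n`.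
[cite: Madras1995LatticeAnimalsExponent, §2 (two dimensions: `p_{2n+K} ≥ c n^{1/2} p_n²`); Hammond2015SAPJoining, Lemma 4.9 (arXiv v5 pp. 24–25)] -/
theorem card_joinDomain_ge (n : ℕ) (hn : 2 ≤ n) :
    (1 / 3 : ℝ) * Real.sqrt ((n + 1) / 2) * (#(canonEnd n) : ℝ) ^ 2 ≤ (#(joinDomain n) : ℝ) := by
  classical
  have hcard : (#(joinDomain n) : ℝ) = #(canonEnd n) * ∑ ω ∈ tallCanon n, (rowCount (n + 1) ω : ℝ) := by
    rw [card_joinDomain]; push_cast; rfl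
  have hsum : (#(tallCanon n) : ℝ) * Real.sqrt ((n + 1) / 2) ≤ ∑ ω ∈ tallCanon n, (rowCount (n + 1) ω : ℝ) := by
    have h := Finset.card_nsmul_le_sum (tallCanon n) (fun ω => (rowCount (n + 1) ω : ℝ)) (Real.sqrt ((n + 1) / 2))
      (fun ω hω => sqrt_le_rowCount hω)
    rwa [nsmul_eq_mul] at h
  have htall : (#(canonEnd n) : ℝ) ≤ 3 * #(tallCanon n) := by exact_mod_cast card_canonEnd_le_three_mul_tall hn
  have hq : (0 : ℝ) ≤ #(canonEnd n) := Nat.cast_nonneg _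
  have hs : (0 : ℝ) ≤ Real.sqrt ((n + 1) / 2) := Real.sqrt_nonneg _
  calc (1 / 3 : ℝ) * Real.sqrt ((n + 1) / 2) * (#(canonEnd n) : ℝ) ^ 2
      = #(canonEnd n) * ((#(canonEnd n) / 3) * Real.sqrt ((n + 1) / 2)) := by ring
    _ ≤ #(canonEnd n) * (#(tallCanon n) * Real.sqrt ((n + 1) / 2)) := by
        apply mul_le_mul_of_nonneg_left _ hq
        exact mul_le_mul_of_nonneg_right (by linarith) hs
    _ ≤ #(canonEnd n) * ∑ ω ∈ tallCanon n, (rowCount (n + 1) ω : ℝ) := mul_le_mul_of_nonneg_left hsum hq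
    _ = (#(joinDomain n) : ℝ) := hcard.symm

end HexBW

open HexBW HexBW.PolygonConcat

/-- **The join-map specification at length `N` on `ℍ`** (brick-wall frame): a finite domain `D` of size at least `c·√N·q_N(ℍ)²`, mapped
injectively into the canonical traversals `canonEnd (2N + K − 1)` of the `(2N+K)`-gons.  [cite: Madras1995LatticeAnimalsExponent, §2 (the injective join at `Ω(n^{1/2})` heights; primary, not held by the lane); Hammond2015SAPJoining, Definition 4.3 p. 20 (arXiv v5: the Madras join polygon)] -/
def JoinMapSpecHex (c : ℝ) (K N : ℕ) : Prop :=
  ∃ (ι : Type) (D : Finset ι) (Ψ : ι → (ℕ → Site 2)),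
    c * Real.sqrt N * (hexPolygonNumber N : ℝ) ^ 2 ≤ (D.card : ℝ) ∧ (∀ x ∈ D, Ψ x ∈ canonEnd (2 * N + K - 1)) ∧ Set.InjOn Ψ ↑D

/-- **The join inequality from the specification**: `c·√N·q_N(ℍ)² ≤ q_{2N+K}(ℍ)` (count the domain through the injective map; `2N + K ≥ 3`).
[cite: Madras1995LatticeAnimalsExponent, §2; Hammond2015SAPJoining, §3.4 eq. (3.6) pp. 12–13 (arXiv v5: Madras' counting)] -/
theorem joinIneqHex_of_spec {c : ℝ} {K N : ℕ} (hNK : 3 ≤ 2 * N + K) (h : JoinMapSpecHex c K N) :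
    c * Real.sqrt N * (hexPolygonNumber N : ℝ) ^ 2 ≤ hexPolygonNumber (2 * N + K) := by
  classical
  obtain ⟨ι, D, Ψ, hD, hΨ, hinj⟩ := h
  have hcard : D.card ≤ (canonEnd (2 * N + K - 1)).card := by
    calc D.card = (D.image Ψ).card := (Finset.card_image_of_injOn hinj).symm
      _ ≤ (canonEnd (2 * N + K - 1)).card :=
          Finset.card_le_card (fun y hy => by
            obtain ⟨x, hx, rfl⟩ := Finset.mem_image.1 hy
            exact hΨ x hx)
  have hq : (canonEnd (2 * N + K - 1)).card = hexPolygonNumber (2 * N + K) := by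
    rw [card_canonEnd (by omega), show 2 * N + K - 1 + 1 = 2 * N + K by omega]
  calc c * Real.sqrt N * (hexPolygonNumber N : ℝ) ^ 2 ≤ (D.card : ℝ) := hD
    _ ≤ ((canonEnd (2 * N + K - 1)).card : ℝ) := by exact_mod_cast hcard
    _ = (hexPolygonNumber (2 * N + K) : ℝ) := by rw [hq]

/-- **Madras' bound on `ℍ` from the join-map specification**: if for some `c > 0`, an even `K` and all even `N ≥ N₀` the join map of length `N`
exists (`JoinMapSpecHex c K N`), then `q_N(ℍ) ≤ A·N^{−1/2}·μ_ℍ^N` for all `N ≥ 1` — LINE «HEX-MADRAS» is closed modulo `JoinMapSpecHex`.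
[cite: Madras1995LatticeAnimalsExponent, §2 (θ ≥ 1/2 in two dimensions; primary, not held by the lane); Hammond2015SAPJoining, §2 p. 4 (arXiv v5)] -/
theorem hexPolygonNumber_le_rpow_of_joinMapSpec {c : ℝ} {K N₀ : ℕ} (hc : 0 < c) (hK : Even K)
    (h : ∀ N : ℕ, N₀ ≤ N → Even N → JoinMapSpecHex c K N) :
    ∃ A : ℝ, ∀ N : ℕ, 1 ≤ N → (hexPolygonNumber N : ℝ) ≤ A * (N : ℝ) ^ (-(1 / 2 : ℝ)) * hexConnectiveConstant ^ N := by
  refine hexPolygonNumber_le_rpow_of_joinIneq (K := K) (N₀ := max N₀ 2) hc hK fun N hN hNe => ?_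
  exact joinIneqHex_of_spec (by omega) (h N (le_of_max_le_left hN) hNe)

/-- The same with the Duminil-Copin–Smirnov value: **`q_N(ℍ) ≤ A·N^{−1/2}·√(2+√2)^N`** from the join-map specification.
[cite: Madras1995LatticeAnimalsExponent, §2 (primary, not held by the lane); Hammond2015SAPJoining, §2 p. 4 (arXiv v5); DuminilCopinSmirnov2012, Theorem 1] -/
theorem hexPolygonNumber_le_rpow_sqrt_of_joinMapSpec {c : ℝ} {K N₀ : ℕ} (hc : 0 < c) (hK : Even K)
    (h : ∀ N : ℕ, N₀ ≤ N → Even N → JoinMapSpecHex c K N) :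
    ∃ A : ℝ, ∀ N : ℕ, 1 ≤ N → (hexPolygonNumber N : ℝ) ≤ A * (N : ℝ) ^ (-(1 / 2 : ℝ)) * Real.sqrt (2 + Real.sqrt 2) ^ N := by
  rw [← hexConnectiveConstant_eq_of_thm1 DuminilCopinSmirnov2012_thm1_holds]
  exact hexPolygonNumber_le_rpow_of_joinMapSpec hc hK h

/-- **From an injective join map on the domain to the specification**: any map `HexBW.joinDomain (N−1) → canonEnd (2N+K−1)` that is injective on
the domain witnesses `JoinMapSpecHex (1/(3√2)) K N` (`N ≥ 3`).
[cite: Madras1995LatticeAnimalsExponent, §2 (primary, not held by the lane); Hammond2015SAPJoining, §4.1 (arXiv v5 pp. 17–20)] -/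
theorem joinMapSpecHex_of_injOn {N K : ℕ} (hN : 3 ≤ N)
    (Ψ : (Σ _ : (ℕ → Site 2) × (ℕ → Site 2), ℤ) → (ℕ → Site 2))
    (hΨ : ∀ x ∈ HexBW.joinDomain (N - 1), Ψ x ∈ canonEnd (2 * N + K - 1))
    (hinj : Set.InjOn Ψ ↑(HexBW.joinDomain (N - 1))) : JoinMapSpecHex (1 / (3 * Real.sqrt 2)) K N := by
  refine ⟨_, HexBW.joinDomain (N - 1), Ψ, ?_, hΨ, hinj⟩
  have h := HexBW.card_joinDomain_ge (N - 1) (by omega)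
  have hN' : ((N - 1 : ℕ) : ℝ) + 1 = (N : ℝ) := by
    rw [Nat.cast_sub (by omega)]; push_cast; ring
  rw [hN'] at h
  have hq : (hexPolygonNumber N : ℝ) = #(canonEnd (N - 1)) := by
    rw [card_canonEnd (by omega), show N - 1 + 1 = N by omega]
  rw [hq]
  have hsqrt : Real.sqrt ((N : ℝ) / 2) = Real.sqrt N / Real.sqrt 2 := by
    rw [Real.sqrt_div' _ (by norm_num : (0 : ℝ) ≤ 2)]
  calc 1 / (3 * Real.sqrt 2) * Real.sqrt N * (#(canonEnd (N - 1)) : ℝ) ^ 2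
      = (1 / 3 : ℝ) * Real.sqrt ((N : ℝ) / 2) * (#(canonEnd (N - 1)) : ℝ) ^ 2 := by rw [hsqrt]; ring
    _ ≤ _ := h

/-! ### Several contact types with different edge budgets: the family form of the specification -/

/-- `q_n(ℍ) ≤ q_{n+4j}(ℍ)` for `n ≥ 3` (iterated `hexPolygonNumber_le_add_four`).
[cite: MadrasSlade1993, Theorem 3.2.3 (3.2.3) p. 64 (ℤ^d: q_N ≤ q_{N+2}; honeycomb edition with +4, tree `HexBW.hexPolygonNumber_le_add_four`)] -/
theorem HexBW.hexPolygonNumber_le_add_four_mul {n : ℕ} (hn : 3 ≤ n) (j : ℕ) : hexPolygonNumber n ≤ hexPolygonNumber (n + 4 * j) := by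
  induction j with
  | zero => simp
  | succ j ih =>
    calc hexPolygonNumber n ≤ hexPolygonNumber (n + 4 * j) := ih
      _ ≤ hexPolygonNumber (n + 4 * j + 4) := hexPolygonNumber_le_add_four (by omega)
      _ = hexPolygonNumber (n + 4 * (j + 1)) := by ring_nf

/-- **Family form of the join inequality** (several contact types with different cap costs): if a finite domain `D` of size `≥ c·√N·q_N(ℍ)²`
is covered by `m` pieces `D i`, each mapped injectively into the canonical traversals of the `(2N + K i)`-gons with `K i ≤ K` and
`K − K i ≡ 0 (mod 4)`, then `c·√N·q_N(ℍ)² ≤ m · q_{2N+K}(ℍ)` — by the monotonicity `q_n ≤ q_{n+4}` the budgets are padded to the largest one.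
[cite: Madras1995LatticeAnimalsExponent, §2 (primary, not held by the lane); MadrasSlade1993, Theorem 3.2.3 (3.2.3) p. 64 (monotonicity); Hammond2015SAPJoining, §4.1 (arXiv v5 pp. 17–20: several local cases of the join)] -/
theorem joinIneqHex_of_family {c : ℝ} {K N m : ℕ} {ι : Type} (D : Finset ι) (piece : Fin m → Finset ι) (Kf : Fin m → ℕ)
    (Ψ : Fin m → ι → (ℕ → Site 2)) (hN : 2 ≤ N) (hD : c * Real.sqrt N * (hexPolygonNumber N : ℝ) ^ 2 ≤ (D.card : ℝ))
    (hcover : ∀ x ∈ D, ∃ i, x ∈ piece i) (hK : ∀ i, Kf i ≤ K ∧ (K - Kf i) % 4 = 0)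
    (hΨ : ∀ i, ∀ x ∈ piece i, Ψ i x ∈ canonEnd (2 * N + Kf i - 1)) (hinj : ∀ i, Set.InjOn (Ψ i) ↑(piece i)) :
    c * Real.sqrt N * (hexPolygonNumber N : ℝ) ^ 2 ≤ m * hexPolygonNumber (2 * N + K) := by
  classical
  -- each piece is at most `q_{2N + K i} ≤ q_{2N + K}`
  have hpiece : ∀ i, (piece i).card ≤ hexPolygonNumber (2 * N + K) := by
    intro i
    obtain ⟨hKi, hmod⟩ := hK i
    have h1 : (piece i).card ≤ (canonEnd (2 * N + Kf i - 1)).card := by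
      calc (piece i).card = ((piece i).image (Ψ i)).card := (Finset.card_image_of_injOn (hinj i)).symm
        _ ≤ (canonEnd (2 * N + Kf i - 1)).card :=
            Finset.card_le_card fun y hy => by
              obtain ⟨x, hx, rfl⟩ := Finset.mem_image.1 hy
              exact hΨ i x hx
    rw [card_canonEnd (by omega), show 2 * N + Kf i - 1 + 1 = 2 * N + Kf i by omega] at h1
    obtain ⟨j, hj⟩ : ∃ j, K - Kf i = 4 * j := ⟨(K - Kf i) / 4, by omega⟩
    have h2 := HexBW.hexPolygonNumber_le_add_four_mul (n := 2 * N + Kf i) (by omega) j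
    rw [show 2 * N + Kf i + 4 * j = 2 * N + K by omega] at h2
    exact h1.trans h2
  -- the cover bound
  have hcard : D.card ≤ ∑ i : Fin m, (piece i).card := by
    calc D.card ≤ (Finset.univ.biUnion piece).card :=
          Finset.card_le_card fun x hx => by
            obtain ⟨i, hi⟩ := hcover x hx
            exact Finset.mem_biUnion.2 ⟨i, Finset.mem_univ _, hi⟩
      _ ≤ ∑ i : Fin m, (piece i).card := Finset.card_biUnion_le
  have hsum : ∑ i : Fin m, (piece i).card ≤ m * hexPolygonNumber (2 * N + K) := by
    calc ∑ i : Fin m, (piece i).card ≤ ∑ _i : Fin m, hexPolygonNumber (2 * N + K) := Finset.sum_le_sum fun i _ => hpiece i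
      _ = m * hexPolygonNumber (2 * N + K) := by rw [Finset.sum_const, Finset.card_univ, Fintype.card_fin, smul_eq_mul]
  calc c * Real.sqrt N * (hexPolygonNumber N : ℝ) ^ 2 ≤ (D.card : ℝ) := hD
    _ ≤ ((m * hexPolygonNumber (2 * N + K) : ℕ) : ℝ) := by exact_mod_cast hcard.trans hsum
    _ = (m : ℝ) * hexPolygonNumber (2 * N + K) := by push_cast; ring

/-- **The family specification implies the plain one with constant `c/m`** — so `hexPolygonNumber_le_rpow_of_joinMapSpec` applies with `c/m`.
[cite: Madras1995LatticeAnimalsExponent, §2 (primary, not held by the lane); Hammond2015SAPJoining, §4.1 (arXiv v5 pp. 17–20)] -/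
theorem joinIneqHex_of_family' {c : ℝ} {K N m : ℕ} {ι : Type} (D : Finset ι) (piece : Fin m → Finset ι) (Kf : Fin m → ℕ)
    (Ψ : Fin m → ι → (ℕ → Site 2)) (hm : 0 < m) (hN : 2 ≤ N) (hD : c * Real.sqrt N * (hexPolygonNumber N : ℝ) ^ 2 ≤ (D.card : ℝ))
    (hcover : ∀ x ∈ D, ∃ i, x ∈ piece i) (hK : ∀ i, Kf i ≤ K ∧ (K - Kf i) % 4 = 0)
    (hΨ : ∀ i, ∀ x ∈ piece i, Ψ i x ∈ canonEnd (2 * N + Kf i - 1)) (hinj : ∀ i, Set.InjOn (Ψ i) ↑(piece i)) :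
    c / m * Real.sqrt N * (hexPolygonNumber N : ℝ) ^ 2 ≤ hexPolygonNumber (2 * N + K) := by
  have h := joinIneqHex_of_family D piece Kf Ψ hN hD hcover hK hΨ hinj
  have hm' : (0 : ℝ) < m := by exact_mod_cast hm
  rw [div_mul_eq_mul_div, div_mul_eq_mul_div, div_le_iff₀ hm']
  calc c * Real.sqrt N * (hexPolygonNumber N : ℝ) ^ 2 ≤ m * hexPolygonNumber (2 * N + K) := h
    _ = (hexPolygonNumber (2 * N + K) : ℝ) * m := mul_comm _ _

end Literature.Probability.RandomPlanarGeometry.SAW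

end
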